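import Mathlib.RingTheory.PowerSeries.Substitution
import Mathlib.RingTheory.PowerSeries.Expand
import Mathlib.RingTheory.PowerSeries.Derivative
import Mathlib.RingTheory.PowerSeries.Trunc
import Mathlib.RingTheory.PowerSeries.Order
import Mathlib.RingTheory.PowerSeries.NoZeroDivisors
import Mathlib.Algebra.Polynomial.Taylor
import Mathlib.Algebra.CharP.Frobenius
import Mathlib.Algebra.CharP.Quotient
import Mathlib.RingTheory.Ideal.Quotient.Basic
import Mathlib.NumberTheory.Padics.RingHoms
import Mathlib.RingTheory.WittVector.Identities
import Mathlib.RingTheory.WittVector.Domain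
import Mathlib.FieldTheory.Perfect
import Literature.NumberTheory.EllipticCurves.DivisionPolynomialFormalMulProofs
import Literature.NumberTheory.EllipticCurves.FormalGroupHasseInvariantProofs
import Literature.RingTheory.FormalGroups.FunctionalEquationIntegrality
import Literature.NumberTheory.EllipticCurves.FormalGroupMultiplicationUniversalProofs
import Literature.NumberTheory.EllipticCurves.FormalGroupLogHomProofs
import Literature.RingTheory.FormalGroups.HondaTypeTransport
import Literature.NumberTheory.EllipticCurves.FormalMulTwoSecondCoeffProofs
import Mathlib.RingTheory.WittVector.FrobeniusFractionField
import Mathlib.RingTheory.WittVector.Compare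
import Mathlib.FieldTheory.Finite.Basic
import Literature.NumberTheory.EllipticCurves.FormalLogExpBaseChangeProofs
import Mathlib.FieldTheory.IsAlgClosed.AlgebraicClosure
import Mathlib.NumberTheory.Padics.Hensel
import Literature.NumberTheory.EllipticCurves.FormalGroupDictionaryProofs
import Literature.NumberTheory.EllipticCurves.HasseInvariantTraceProofs
import Literature.NumberTheory.EllipticCurves.Greenberg1999.TwoTorsionMuInvariant
import Summits.BirchSwinnertonDyer.BirchSwinnertonDyer.Theorems.EisensteinDepletionAtTwoStarGO2KEtaTheoremKPadicA
import HarnessLib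

/-!
# THEOREM K (the 2-adic Kummer class law for `z²(x(z) − x₀)`), kernel formalisation — KEtaTheoremKPadic (part 8b: curve side)
(crux `StarGO2Sigma`, stmt-BirchSwinnertonDyer-27046; line kummer, research stub `stub_discrepancyCover`)

Planner bsd-rank2-p2 GEN 37's Stage F of the monolith `KummerTheoremK_full.lean` (HOME/p2/g37/lean; memo K-UNIV.md §0/§4),
second half (split for the 400-line rule).  This part: the CURVE-SIDE inputs of the Witt-free consumer form
`TheoremKPadic.theoremK_padicInt` (part 8a) — Hensel's unit root of `X² − aX + 2` for odd `a` (`exists_unitRoot_of_odd`),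
`tr(Frob₂) ≡ a₁ (mod 2)` (`intCast_tr_eq_intCast_a₁`, from the tree's `coeff_one_formalMulFrobPart_eq_intCast_tr` at `p = 2`),
the Honda type from good reduction (`hondaType_of_goodReduction`, tree `norm_coeff_hondaShift_formalLog_le_one'`), the
one-stop forms on the kummer v6 binders `HasRationalTwoTorsionX` / `¬TwoTorsionRamifiedAtTwo` (`exists_padicInt_twoTorsionX`,
`theoremK_padicInt_of_rationalTwoTorsion`) and the line form with the `z`-side Dwork witnesses supplied (`theoremK_line`).
Nothing here reads `r_an`; `StarGO2Sigma` / E1M / BSD are NOT proved by this file.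
-/

set_option linter.dupNamespace false
set_option linter.unusedSectionVars false
set_option autoImplicit false

noncomputable section

namespace Summit.BirchSwinnertonDyer.BirchSwinnertonDyer.Theorems.DepletionAtTwo.KEta.TheoremKPadic

open PowerSeries Literature.RingTheory.FormalGroups Literature.NumberTheory.EllipticCurves WittExistence TheoremKWitt

/-! ### The curve-side inputs: the unit root (Hensel) and the Honda type (tree, every prime) -/

/-- For odd `a ∈ ℤ` the polynomial `X² − aX + 2` has a (unique) unit root in `ℤ₂` (Hensel at `1`). -/
theorem exists_unitRoot_of_odd (a : ℤ) (ha : Odd a) :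
    ∃ α : ℤ_[2], ‖α‖ = 1 ∧ (α : ℚ_[2]) ^ 2 - a * α + 2 = 0 := by
  set F : Polynomial ℤ_[2] :=
    Polynomial.X ^ 2 - Polynomial.C (a : ℤ_[2]) * Polynomial.X + Polynomial.C 2 with hF
  have hFa : ∀ z : ℤ_[2], F.aeval z = z ^ 2 - a * z + 2 := fun z => by
    simp [hF]
  have hF'a : ∀ z : ℤ_[2], F.derivative.aeval z = 2 * z - a := fun z => by
    rw [hF, Polynomial.derivative_add, Polynomial.derivative_sub, Polynomial.derivative_X_sq,
      Polynomial.derivative_C_mul, Polynomial.derivative_X, Polynomial.derivative_C, add_zero, mul_one]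
    simp
  have h1 : ‖F.aeval (1 : ℤ_[2])‖ < 1 := by
    rw [hFa, one_pow, mul_one, show (1 : ℤ_[2]) - a + 2 = ((3 - a : ℤ) : ℤ_[2]) by push_cast; ring,
      PadicInt.norm_int_lt_one_iff_dvd]
    obtain ⟨m, hm⟩ := ha
    exact ⟨1 - m, by rw [hm]; ring⟩
  have h2 : ‖F.derivative.aeval (1 : ℤ_[2])‖ = 1 := by
    rw [hF'a, mul_one, show (2 : ℤ_[2]) - a = ((2 - a : ℤ) : ℤ_[2]) by push_cast; ring]
    refine le_antisymm (PadicInt.norm_le_one _) (not_lt.mp fun hlt => ?_)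
    rw [PadicInt.norm_int_lt_one_iff_dvd] at hlt
    obtain ⟨m, hm⟩ := ha
    obtain ⟨c, hc⟩ := hlt
    omega
  have hnorm : ‖F.aeval (1 : ℤ_[2])‖ < ‖F.derivative.aeval (1 : ℤ_[2])‖ ^ 2 := by
    rw [h2, one_pow]; exact h1
  obtain ⟨z, hz, hz1, -, -⟩ := hensels_lemma hnorm
  rw [h2] at hz1
  refine ⟨z, ?_, ?_⟩
  · refine le_antisymm (PadicInt.norm_le_one _) (not_lt.mp fun hlt => ?_)
    have h : ‖(1 : ℤ_[2])‖ < 1 := by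
      have e : (1 : ℤ_[2]) = z + -(z - 1) := by ring
      rw [e]
      refine lt_of_le_of_lt (PadicInt.nonarchimedean _ _) (max_lt hlt ?_)
      rwa [norm_neg]
    rw [norm_one] at h
    exact lt_irrefl _ h
  · have h := hz
    rw [hFa] at h
    have h' := congrArg (PadicInt.Coe.ringHom (p := 2)) h
    rw [map_add, map_sub, map_mul, map_pow, map_intCast, map_ofNat, map_zero] at h'
    exact h'

/-- **`tr(Frob₂) ≡ a₁ (mod 2)`**: at `p = 2` the reduced Verschiebung `g` (`[2]‾ = g(X²)`) has
`g'(0) = [X²][2] = −a₁` (tree `coeff_two_formalMul_two`) and `g'(0) = tr` (tree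
`coeff_one_formalMulFrobPart_eq_intCast_tr`, every prime).  Hence ordinary at `2` ⟺ `a₁` odd. -/
theorem intCast_tr_eq_intCast_a₁ (W : WeierstrassCurve ℤ)
    [((W.map (Int.castRingHom ℤ_[2])).map (PadicInt.toZMod (p := 2))).IsElliptic] :
    ((Literature.NumberTheory.EllipticCurves.HasseManin.tr
        ((W.map (Int.castRingHom ℤ_[2])).map (PadicInt.toZMod (p := 2))) : ℤ) : ZMod 2) =
      ((W.a₁ : ℤ) : ZMod 2) := by
  have h := WeierstrassCurve.coeff_one_formalMulFrobPart_eq_intCast_tr (p := 2)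
    ((W.map (Int.castRingHom ℤ_[2])).map (PadicInt.toZMod (p := 2)))
  rw [WeierstrassCurve.formalMulFrobPart, coeff_mk, mul_one, WeierstrassCurve.coeff_two_formalMul_two,
    WeierstrassCurve.map_a₁, WeierstrassCurve.map_a₁, eq_intCast, map_intCast, CharTwo.neg_eq] at h
  exact h.symm

/-- The Hasse–Manin trace of the special fibre at `2` is odd iff `a₁` is odd (`tr ≡ a₁ (mod 2)`): ordinary at `2` ⟺ `a₁` odd. -/
theorem odd_tr_iff_odd_a₁ (W : WeierstrassCurve ℤ)
    [((W.map (Int.castRingHom ℤ_[2])).map (PadicInt.toZMod (p := 2))).IsElliptic] :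
    Odd (Literature.NumberTheory.EllipticCurves.HasseManin.tr
        ((W.map (Int.castRingHom ℤ_[2])).map (PadicInt.toZMod (p := 2)))) ↔ Odd W.a₁ := by
  have h := (ZMod.intCast_eq_intCast_iff _ _ 2).mp (intCast_tr_eq_intCast_a₁ W)
  simp only [Int.ModEq, Nat.cast_ofNat] at h
  rw [Int.odd_iff, Int.odd_iff, h]

/-- The unit root `α` of `X² − tr·X + 2` exists for `W` ordinary at `2`, i.e. `a₁` odd (Hensel). -/
theorem exists_unitRoot_tr (W : WeierstrassCurve ℤ)
    [((W.map (Int.castRingHom ℤ_[2])).map (PadicInt.toZMod (p := 2))).IsElliptic] (ha1 : Odd W.a₁) :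
    ∃ α : ℤ_[2], ‖α‖ = 1 ∧ (α : ℚ_[2]) ^ 2 -
      ((Literature.NumberTheory.EllipticCurves.HasseManin.tr
          ((W.map (Int.castRingHom ℤ_[2])).map (PadicInt.toZMod (p := 2))) : ℤ) : ℚ_[2]) * α + 2 = 0 :=
  exists_unitRoot_of_odd _ ((odd_tr_iff_odd_a₁ W).mpr ha1)

/-- **Honda type at `2` from good reduction** (tree `norm_coeff_hondaShift_formalLog_le_one'`, with
`a = tr(Frob₂) = 3 − #W̄(𝔽₂)`), restated for `W/ℤ`; only the SPECIAL fibre need be assumed elliptic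
(tree `isElliptic_map_coe_of_isElliptic_map_toZMod`). -/
theorem hondaType_of_goodReduction (W : WeierstrassCurve ℤ)
    [((W.map (Int.castRingHom ℤ_[2])).map (PadicInt.toZMod (p := 2))).IsElliptic] (n : ℕ) :
    ‖coeff n (hondaShift 2
      ((Literature.NumberTheory.EllipticCurves.HasseManin.tr
          ((W.map (Int.castRingHom ℤ_[2])).map (PadicInt.toZMod (p := 2))) : ℤ) : ℚ_[2])
      (W.map (Int.castRingHom ℚ_[2])).formalLog)‖ ≤ 1 := by
  haveI := WeierstrassCurve.isElliptic_map_coe_of_isElliptic_map_toZMod (p := 2)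
    (W.map (Int.castRingHom ℤ_[2]))
  have h := WeierstrassCurve.norm_coeff_hondaShift_formalLog_le_one' (p := 2)
    (W.map (Int.castRingHom ℤ_[2])) n
  have e : (W.map (Int.castRingHom ℤ_[2])).map (PadicInt.Coe.ringHom (p := 2)) =
      W.map (Int.castRingHom ℚ_[2]) := by
    rw [WeierstrassCurve.map_map,
      RingHom.ext_int ((PadicInt.Coe.ringHom (p := 2)).comp (Int.castRingHom ℤ_[2])) (Int.castRingHom ℚ_[2])]
  rw [e] at h
  exact h

/-- **THEOREM K over `ℤ₂/𝔽₂` for a curve with good reduction at `2`.**  `W/ℤ` with elliptic special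
fibre at `2` (good reduction), `a := tr(Frob₂)`, `α ∈ ℤ₂^×` the unit root of `X² − aX + 2`
(`exists_unitRoot_tr`: it exists as soon as `a₁` is odd, i.e. `W` ordinary at `2`), `x₀ ∈ ℤ₂` an integral
`2`-torsion `x`-coordinate, `a₁` odd.  Conclusion as in `theoremK_padicInt`, with the Honda type
supplied by the tree. -/
theorem theoremK_padicInt_of_goodReduction (W : WeierstrassCurve ℤ)
    [((W.map (Int.castRingHom ℤ_[2])).map (PadicInt.toZMod (p := 2))).IsElliptic]
    {α : ℤ_[2]} (hαn : ‖α‖ = 1)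
    (hroot : (α : ℚ_[2]) ^ 2 -
      ((Literature.NumberTheory.EllipticCurves.HasseManin.tr
          ((W.map (Int.castRingHom ℤ_[2])).map (PadicInt.toZMod (p := 2))) : ℤ) : ℚ_[2]) * α + 2 = 0)
    {x₀ : ℤ_[2]}
    (hx : 4 * x₀ ^ 3 + (W.map (Int.castRingHom ℤ_[2])).b₂ * x₀ ^ 2 +
      2 * (W.map (Int.castRingHom ℤ_[2])).b₄ * x₀ + (W.map (Int.castRingHom ℤ_[2])).b₆ = 0)
    (ha1 : Odd W.a₁) :
    ∃ sbar : PowerSeries (ZMod 2), constantCoeff sbar = 0 ∧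
      sbar - sbar ^ 2 = (lamInt W _ hαn hroot (hondaType_of_goodReduction W)).map (PadicInt.toZMod (p := 2)) ∧
      ∀ (z dz δgz : PowerSeries ℤ_[2]), constantCoeff z = 0 →
        Kernel.phi (RingHom.id ℤ_[2]) z = z ^ 2 + 2 * dz →
        Kernel.phi (RingHom.id ℤ_[2])
            (((W.map (Int.castRingHom ℤ_[2])).formalXMulSq - C x₀ * X ^ 2).subst z) =
          (((W.map (Int.castRingHom ℤ_[2])).formalXMulSq - C x₀ * X ^ 2).subst z) ^ 2 + 2 * δgz →
        δgz.map (PadicInt.toZMod (p := 2)) =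
          (PowerSeries.map (PadicInt.toZMod (p := 2))
              (((W.map (Int.castRingHom ℤ_[2])).formalXMulSq - C x₀ * X ^ 2).subst z)) ^ 2 *
            (sbar.subst (z.map (PadicInt.toZMod (p := 2))) +
              ((((W.map (Int.castRingHom ℤ_[2])).formalInvDiff).map (PadicInt.toZMod (p := 2))).subst
                  (z.map (PadicInt.toZMod (p := 2)))) ^ 2 *
                dz.map (PadicInt.toZMod (p := 2))) :=
  theoremK_padicInt W _ hαn hroot (hondaType_of_goodReduction W) hx ha1


/-! ### One-stop form on the line's hypotheses: rational étale `2`-torsion (`x₀ ∈ ℚ`, `v₂(x₀) ≥ 0`) -/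

/-- The lead's rational étale `2`-torsion `x`-coordinate is `2`-adically integral and is a root of the
`2`-division cubic over `ℤ₂`. -/
theorem exists_padicInt_twoTorsionX (W : WeierstrassCurve ℤ) {x₀ : ℚ}
    (hx : Greenberg1999.HasRationalTwoTorsionX (W.map (Int.castRingHom ℚ)) x₀)
    (hv : ¬ Greenberg1999.TwoTorsionRamifiedAtTwo x₀) :
    ∃ ξ : ℤ_[2], (ξ : ℚ_[2]) = ((x₀ : ℚ) : ℚ_[2]) ∧
      4 * ξ ^ 3 + (W.map (Int.castRingHom ℤ_[2])).b₂ * ξ ^ 2 +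
        2 * (W.map (Int.castRingHom ℤ_[2])).b₄ * ξ + (W.map (Int.castRingHom ℤ_[2])).b₆ = 0 := by
  obtain ⟨y, heq, h2⟩ := hx
  rw [WeierstrassCurve.Affine.equation_iff] at heq
  simp only [WeierstrassCurve.toAffine, WeierstrassCurve.map_a₁, WeierstrassCurve.map_a₂,
    WeierstrassCurve.map_a₃, WeierstrassCurve.map_a₄, WeierstrassCurve.map_a₆, eq_intCast] at heq h2
  have hcubic : 4 * x₀ ^ 3 + (W.b₂ : ℚ) * x₀ ^ 2 + 2 * (W.b₄ : ℚ) * x₀ + (W.b₆ : ℚ) = 0 := by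
    simp only [WeierstrassCurve.b₂, WeierstrassCurve.b₄, WeierstrassCurve.b₆]; push_cast
    linear_combination (2 * y + (W.a₁ : ℚ) * x₀ + W.a₃) * h2 - 4 * heq
  have hnorm : ‖((x₀ : ℚ) : ℚ_[2])‖ ≤ 1 := by
    rw [Greenberg1999.twoTorsionRamifiedAtTwo_iff, not_lt] at hv
    rcases eq_or_ne x₀ 0 with h0 | h0
    · simp [h0]
    rw [Padic.eq_padicNorm, padicNorm.eq_zpow_of_nonzero h0]; push_cast
    exact zpow_le_one_of_nonpos₀ (by norm_num) (neg_nonpos.mpr hv)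
  refine ⟨⟨_, hnorm⟩, rfl, ?_⟩
  refine (PadicInt.coe_eq_zero (p := 2)).mp ?_
  simp only [WeierstrassCurve.map_b₂, WeierstrassCurve.map_b₄, WeierstrassCurve.map_b₆, eq_intCast]
  push_cast
  have h := congrArg (fun r : ℚ => (r : ℚ_[2])) hcubic
  push_cast at h
  exact h

/-- **THEOREM K on the line's hypotheses.**  `W/ℤ` with good reduction at `2` and `a₁` odd (ordinary),
`x₀ ∈ ℚ` the `x`-coordinate of a rational point of order `2` not in the kernel of reduction mod `2`
(`HasRationalTwoTorsionX`, `¬ TwoTorsionRamifiedAtTwo` — exactly the binders of kummer v6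
`stub_discrepancyCover`).  THEN the unit root `α`, the `2`-adic integer `ξ = x₀` and the Artin–Schreier
root `s̄` of `Λ̄_α` exist and the `ℤ₂/𝔽₂` class law of `theoremK_padicInt` holds for
`g = T²(x_W(T) − ξ)`. -/
theorem theoremK_padicInt_of_rationalTwoTorsion (W : WeierstrassCurve ℤ)
    [((W.map (Int.castRingHom ℤ_[2])).map (PadicInt.toZMod (p := 2))).IsElliptic]
    (ha1 : Odd W.a₁) {x₀ : ℚ}
    (hx : Greenberg1999.HasRationalTwoTorsionX (W.map (Int.castRingHom ℚ)) x₀)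
    (hv : ¬ Greenberg1999.TwoTorsionRamifiedAtTwo x₀) :
    ∃ (α : ℤ_[2]) (hαn : ‖α‖ = 1)
      (hroot : (α : ℚ_[2]) ^ 2 -
        ((Literature.NumberTheory.EllipticCurves.HasseManin.tr
            ((W.map (Int.castRingHom ℤ_[2])).map (PadicInt.toZMod (p := 2))) : ℤ) : ℚ_[2]) * α + 2 = 0)
      (ξ : ℤ_[2]), (ξ : ℚ_[2]) = ((x₀ : ℚ) : ℚ_[2]) ∧
    ∃ sbar : PowerSeries (ZMod 2), constantCoeff sbar = 0 ∧
      sbar - sbar ^ 2 = (lamInt W _ hαn hroot (hondaType_of_goodReduction W)).map (PadicInt.toZMod (p := 2)) ∧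
      ∀ (z dz δgz : PowerSeries ℤ_[2]), constantCoeff z = 0 →
        Kernel.phi (RingHom.id ℤ_[2]) z = z ^ 2 + 2 * dz →
        Kernel.phi (RingHom.id ℤ_[2])
            (((W.map (Int.castRingHom ℤ_[2])).formalXMulSq - C ξ * X ^ 2).subst z) =
          (((W.map (Int.castRingHom ℤ_[2])).formalXMulSq - C ξ * X ^ 2).subst z) ^ 2 + 2 * δgz →
        δgz.map (PadicInt.toZMod (p := 2)) =
          (PowerSeries.map (PadicInt.toZMod (p := 2))
              (((W.map (Int.castRingHom ℤ_[2])).formalXMulSq - C ξ * X ^ 2).subst z)) ^ 2 *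
            (sbar.subst (z.map (PadicInt.toZMod (p := 2))) +
              ((((W.map (Int.castRingHom ℤ_[2])).formalInvDiff).map (PadicInt.toZMod (p := 2))).subst
                  (z.map (PadicInt.toZMod (p := 2)))) ^ 2 *
                dz.map (PadicInt.toZMod (p := 2))) := by
  obtain ⟨α, hαn, hroot⟩ := exists_unitRoot_tr W ha1
  obtain ⟨ξ, hξ, hξc⟩ := exists_padicInt_twoTorsionX W hx hv
  exact ⟨α, hαn, hroot, ξ, hξ, theoremK_padicInt_of_goodReduction W hαn hroot hξc ha1⟩


/-! ### The `z`-side is free over `ℤ₂`: Dwork witnesses always exist -/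

/-- Over `ℤ₂` (Frobenius lift `φ(u)(q) = u(q²)`), EVERY `u ∈ ℤ₂⟦q⟧` has a Dwork witness `δ`:
`u(q²) = u(q)² + 2δ` (because `ū(q²) = ū(q)²` in `𝔽₂⟦q⟧`).  So the binders `dz`, `δgz` of
`theoremK_padicInt*` are never a constraint on the modular point `z`; and they are UNIQUE
(`ℤ₂⟦q⟧` has no `2`-torsion), so any explicit formula for them may be substituted. -/
theorem exists_delta_padicInt (u : PowerSeries ℤ_[2]) :
    ∃ δ : PowerSeries ℤ_[2], Kernel.phi (RingHom.id ℤ_[2]) u = u ^ 2 + 2 * δ :=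
  Kernel.exists_delta Kernel.frobeniusLift_padicInt_two.2.1 Kernel.frobeniusLift_padicInt_two.2.2 u

/-- The Dwork witness `δ` with `u(X²) = u² + 2δ` over `ℤ₂` is unique (`ℤ₂⟦X⟧` has no `2`-torsion). -/
theorem delta_unique_padicInt {u δ₁ δ₂ : PowerSeries ℤ_[2]}
    (h₁ : Kernel.phi (RingHom.id ℤ_[2]) u = u ^ 2 + 2 * δ₁)
    (h₂ : Kernel.phi (RingHom.id ℤ_[2]) u = u ^ 2 + 2 * δ₂) : δ₁ = δ₂ := by
  have h : (2 : PowerSeries ℤ_[2]) * (δ₁ - δ₂) = 0 := by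
    rw [mul_sub, sub_eq_zero]
    have := h₁.symm.trans h₂
    exact add_left_cancel this
  have h2 : (C (2 : ℤ_[2]) : PowerSeries ℤ_[2]) = 2 := map_ofNat C 2
  rw [← h2] at h
  have hne : (C (2 : ℤ_[2]) : PowerSeries ℤ_[2]) ≠ 0 := by
    rw [Ne, map_eq_zero_iff C (C_injective (R := ℤ_[2]))]; norm_num
  exact sub_eq_zero.mp ((mul_eq_zero.mp h).resolve_left hne)

/-- **THEOREM K, line form**: on the kummer v6 binders for `x₀` plus good reduction at `2` and `a₁` odd,
for EVERY `z ∈ qℤ₂⟦q⟧` the Dwork witnesses `d_z`, `δ_{g∘z}` exist (uniquely) and satisfy the class law. -/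
theorem theoremK_line (W : WeierstrassCurve ℤ)
    [((W.map (Int.castRingHom ℤ_[2])).map (PadicInt.toZMod (p := 2))).IsElliptic]
    (ha1 : Odd W.a₁) {x₀ : ℚ}
    (hx : Greenberg1999.HasRationalTwoTorsionX (W.map (Int.castRingHom ℚ)) x₀)
    (hv : ¬ Greenberg1999.TwoTorsionRamifiedAtTwo x₀) :
    ∃ (α : ℤ_[2]) (hαn : ‖α‖ = 1)
      (hroot : (α : ℚ_[2]) ^ 2 -
        ((Literature.NumberTheory.EllipticCurves.HasseManin.tr
            ((W.map (Int.castRingHom ℤ_[2])).map (PadicInt.toZMod (p := 2))) : ℤ) : ℚ_[2]) * α + 2 = 0)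
      (ξ : ℤ_[2]), (ξ : ℚ_[2]) = ((x₀ : ℚ) : ℚ_[2]) ∧
    ∃ sbar : PowerSeries (ZMod 2), constantCoeff sbar = 0 ∧
      sbar - sbar ^ 2 = (lamInt W _ hαn hroot (hondaType_of_goodReduction W)).map (PadicInt.toZMod (p := 2)) ∧
      ∀ z : PowerSeries ℤ_[2], constantCoeff z = 0 →
        ∃ dz δgz : PowerSeries ℤ_[2],
          Kernel.phi (RingHom.id ℤ_[2]) z = z ^ 2 + 2 * dz ∧
          Kernel.phi (RingHom.id ℤ_[2])
              (((W.map (Int.castRingHom ℤ_[2])).formalXMulSq - C ξ * X ^ 2).subst z) =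
            (((W.map (Int.castRingHom ℤ_[2])).formalXMulSq - C ξ * X ^ 2).subst z) ^ 2 + 2 * δgz ∧
          δgz.map (PadicInt.toZMod (p := 2)) =
            (PowerSeries.map (PadicInt.toZMod (p := 2))
                (((W.map (Int.castRingHom ℤ_[2])).formalXMulSq - C ξ * X ^ 2).subst z)) ^ 2 *
              (sbar.subst (z.map (PadicInt.toZMod (p := 2))) +
                ((((W.map (Int.castRingHom ℤ_[2])).formalInvDiff).map (PadicInt.toZMod (p := 2))).subst
                    (z.map (PadicInt.toZMod (p := 2)))) ^ 2 *
                  dz.map (PadicInt.toZMod (p := 2))) := by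
  obtain ⟨α, hαn, hroot, ξ, hξ, sbar, hs0, hAS, hlaw⟩ := theoremK_padicInt_of_rationalTwoTorsion W ha1 hx hv
  refine ⟨α, hαn, hroot, ξ, hξ, sbar, hs0, hAS, fun z hz => ?_⟩
  obtain ⟨dz, hdz⟩ := exists_delta_padicInt z
  obtain ⟨δgz, hδ⟩ := exists_delta_padicInt
    (((W.map (Int.castRingHom ℤ_[2])).formalXMulSq - C ξ * X ^ 2).subst z)
  exact ⟨dz, δgz, hdz, hδ, hlaw z dz δgz hz hdz hδ⟩

end Summit.BirchSwinnertonDyer.BirchSwinnertonDyer.Theorems.DepletionAtTwo.KEta.TheoremKPadic
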